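import Summits.Ventures.LatticeQCDFlow.Exactness.IMHTauIntFiniteOfWeightMoment
import HarnessLib

/-!
# Infinite second weight moment ⇒ an indicator observable with non-summable autocovariances

HONEST FRAMING: exact (Metropolis-corrected) sampling algorithms for lattice gauge theory;
figures of merit are autocorrelation/cost numbers at stated couplings and volumes; no
continuum-physics claim.  (SCALAR calibration rung S0-A: not a gauge result.)

Venture `LatticeQCDFlow` (cell pub-lqcd), topic `Exactness`; FANOUT row 2 (`s0-phi4`, FLOW arm).
NEW WORK of the cell: the converse half of the dichotomy begun in
`IMHTauIntFiniteOfWeightMoment.lean`, and the resulting EQUIVALENCE between the cell's two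
figures of merit for the exact flow sampler.  Nothing is cited as a fact (Mengersen–Tweedie 1996:
unbounded weights ⇒ not geometrically ergodic, NAMED ONLY — the statement here is different:
it is about `τ_int` of BOUNDED observables and the threshold is the SECOND weight moment).

## What is proved (`w, q > 0` measurable integrable, `∫ q = 1`, `Z = ∫ w`, `b = w/q`,
`λ = rejCurve`, `K = imhOp μ w q`, `W₂ = ∫ b w dμ = E_q[b²]`)

* `rejOdds_ge` — `λ(v)/(1 − λ(v)) ≥ v/Z − 1` (`v > 0`): rejection odds grow at least linearly;
* `massLe_self_pos` — `Π(Z) = ∫ 1[b ≤ Z] w > 0` (the weight cannot exceed its `q`-mean `Z`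
  almost surely);
* **`not_integrable_stick_indicator`** — if `W₂ = ∞` then for `f = 1[b > v₀]` (`v₀ ≥ Z`) and
  ANY constant `c ≠ 1` the sticking functional of `g = f − c` is infinite:
  `g² w λ(b)/(1−λ(b)) ≥ (1−c)² 1[b > v₀] w (b/Z − 1) ∉ L¹`;
* **`not_summable_autocov_indicator`** — hence the autocovariance series of `g` along the exact
  chain is NOT summable (contrapositive of `integrable_layerCake_of_summable`);
* **`forall_summable_autocov_iff`** — THE DICHOTOMY: every bounded centred observable has a
  summable autocovariance series along the exact flow sampler IF AND ONLY IF `W₂ < ∞`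
  (`Integrable (b·w)`), i.e. iff the Kish effective-sample-size fraction `Z²/W₂` is positive;
* the lattice (`ℝ^Λ`, row 2's `imhOpPhi4 J λ q̃`, every `λ > 0`, real `J`, positive model
  density with `∫ q̃ = 1`): **`phi4Flow_tauInt_le_of_weightMoment`** (the explicit bound of the
  finite half for `g = f − ⟨f⟩`) and **`phi4Flow_forall_summable_iff`**.

Reading for S0-A (no numerics implied): for the flow arm "finite `τ_int` for all bounded
observables" and "positive asymptotic ESS/N of the raw importance sampler" are the same
condition on the trained model; a flow whose weights have an infinite second moment under
itself (tails lighter than the target's in the `L²` sense) leaves the weight super-level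
indicators `1[e^{−S}/q̃ > v₀]` with a non-summable autocovariance series (`τ_int = ∞` in
the physicist's reading; Lean's `tsum` convention returns `½` there), however high the mean
acceptance.
NOT CLAIMED: HMC / local Metropolis; unbounded observables; any number for a trained network.
-/

namespace Summit.Ventures.LatticeQCDFlow.Exactness

open Real MeasureTheory Filter Set Topology
open Summit.Ventures.LatticeQCDFlow.Scoring

variable {X : Type*} [MeasurableSpace X] {μ : Measure X} {w q : X → ℝ}

variable [SFinite μ]

/-! ## Rejection odds from below; the lower mass at the mean weight is positive -/

omit [SFinite μ] in
/-- **`λ(v)/(1 − λ(v)) ≥ v/Z − 1`** for `v > 0` (`1 − λ(v) = M(v)/v ≤ Z/v`). -/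
theorem rejOdds_ge (hw0 : ∀ t, 0 < w t) (hwm : Measurable w) (hwi : Integrable w μ)
    (hq0 : ∀ t, 0 < q t) (hqm : Measurable q) (hqi : Integrable q μ) (hq1 : ∫ z, q z ∂μ = 1)
    {v : ℝ} (hv : 0 < v) :
    v / (∫ z, w z ∂μ) - 1 ≤ rejCurve μ w q v / (1 - rejCurve μ w q v) := by
  have hZ : 0 < ∫ z, w z ∂μ := integral_pos_of_pos hw0 hwi hq1
  have h1 : 0 < 1 - rejCurve μ w q v := sub_pos.2 (rejCurve_lt_one hw0 hwm hq0 hqm hqi hq1 hv)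
  have hM := mul_one_sub_rejCurve hw0 hwm hq0 hqm hqi hq1 hv
  have hMZ : ∫ z, min (w z) (v * q z) ∂μ ≤ ∫ z, w z ∂μ := (clip_le hw0 hwm hwi hq0 hqm hv.le).1
  have e : rejCurve μ w q v / (1 - rejCurve μ w q v) = 1 / (1 - rejCurve μ w q v) - 1 := by
    field_simp
    ring
  rw [e]
  have h : v / (∫ z, w z ∂μ) ≤ 1 / (1 - rejCurve μ w q v) := by
    rw [div_le_div_iff₀ hZ h1, one_mul, hM]
    exact hMZ
  linarith

omit [SFinite μ] in
/-- **`Π(Z) > 0`**: the target mass of `{b ≤ Z}` is positive — the weight `b` has `q`-mean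
`∫ b q = Z`, so it cannot exceed `Z` almost surely. -/
theorem massLe_self_pos (hw0 : ∀ t, 0 < w t) (hwm : Measurable w) (hwi : Integrable w μ)
    (hq0 : ∀ t, 0 < q t) (hqm : Measurable q) (hqi : Integrable q μ) (hq1 : ∫ z, q z ∂μ = 1) :
    0 < massLe μ w q (∫ z, w z ∂μ) := by
  set Z : ℝ := ∫ z, w z ∂μ with hZdef
  obtain ⟨-, iL⟩ := integrable_mass_integrands hw0 hwm hwi hqm Z
  have h0 : 0 ≤ massLe μ w q Z := by
    obtain ⟨h1, h2, -⟩ := massBelow_bounds hw0 hwm hwi hqm Z (μ := μ)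
    exact h1.trans h2
  rcases eq_or_lt_of_le h0 with h | h
  · exfalso
    -- `1[b ≤ Z] w = 0` a.e., so `w - Z q > 0` a.e.; but `∫ (w - Z q) = 0`
    have hae : (fun z => (if w z / q z ≤ Z then w z else 0 : ℝ)) =ᵐ[μ] 0 := by
      refine (integral_eq_zero_iff_of_nonneg (fun z => ?_) iL).1 ?_
      · show (0 : ℝ) ≤ if w z / q z ≤ Z then w z else 0
        split_ifs; exacts [(hw0 z).le, le_rfl]
      · exact h.symm
    have hpos : ∀ᵐ z ∂μ, 0 < w z - Z * q z := by
      filter_upwards [hae] with z hz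
      have hz' : ¬ (w z / q z ≤ Z) := by
        intro hle
        simp only [hle, if_true, Pi.zero_apply] at hz
        exact (hw0 z).ne' hz
      have : Z * q z < w z := (lt_div_iff₀ (hq0 z)).1 (not_le.1 hz')
      linarith
    have hint : Integrable (fun z => w z - Z * q z) μ := hwi.sub (hqi.const_mul Z)
    have hI : ∫ z, (w z - Z * q z) ∂μ = 0 := by
      rw [integral_sub hwi (hqi.const_mul Z), integral_const_mul, hq1, mul_one, sub_self]
    have hI' : 0 < ∫ z, (w z - Z * q z) ∂μ := by
      rw [integral_pos_iff_support_of_nonneg_ae (hpos.mono fun z hz => hz.le) hint]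
      have hsupp : ∀ᵐ z ∂μ, z ∈ Function.support fun z => w z - Z * q z :=
        hpos.mono fun z hz => hz.ne'
      have hμ : μ ≠ 0 := by
        intro hμ0
        rw [hμ0, integral_zero_measure] at hq1
        exact zero_ne_one hq1
      rw [ae_iff] at hsupp
      by_contra hle
      have hle' : μ (Function.support fun z => w z - Z * q z) = 0 := le_antisymm (not_lt.1 hle) bot_le
      have : μ univ = 0 := by
        have hu : (univ : Set X) ⊆ (Function.support fun z => w z - Z * q z)
            ∪ {a | ¬ a ∈ Function.support fun z => w z - Z * q z} := fun z _ => by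
          by_cases hz : z ∈ Function.support fun z => w z - Z * q z
          · exact Or.inl hz
          · exact Or.inr hz
        exact measure_mono_null hu (measure_union_null hle' hsupp)
      exact hμ (Measure.measure_univ_eq_zero.1 this)
    linarith
  · exact h

/-! ## The indicator of a weight super-level set -/

omit [SFinite μ] in
/-- The observable `1[b > v₀] − c` is measurable and bounded by `1 + |c|`. -/
theorem indicator_sub_const_bdd (hwm : Measurable w) (hqm : Measurable q) (v₀ c : ℝ) :
    Measurable (fun x => (if v₀ < w x / q x then (1:ℝ) else 0) - c)
    ∧ ∀ x, |(if v₀ < w x / q x then (1:ℝ) else 0) - c| ≤ 1 + |c| := by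
  refine ⟨(Measurable.ite (measurableSet_lt measurable_const (hwm.div hqm)) measurable_const
    measurable_const).sub measurable_const, fun x => ?_⟩
  refine (abs_sub _ _).trans ?_
  have h1 : |(if v₀ < w x / q x then (1:ℝ) else 0)| ≤ 1 := by split_ifs <;> simp
  linarith

omit [SFinite μ] in
/-- **INFINITE SECOND WEIGHT MOMENT ⇒ INFINITE STICKING FUNCTIONAL.**  If `∫ b w dμ = ∞` then for
`f = 1[b > v₀]` with `v₀ ≥ Z` and ANY constant `c ≠ 1`, the sticking functional of `g = f − c`
is infinite: `g² w λ(b)/(1 − λ(b)) ≥ (1 − c)² 1[b > v₀] w (b/Z − 1)`, which is not integrable. -/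
theorem not_integrable_stick_indicator (hw0 : ∀ t, 0 < w t) (hwm : Measurable w)
    (hwi : Integrable w μ) (hq0 : ∀ t, 0 < q t) (hqm : Measurable q) (hqi : Integrable q μ)
    (hq1 : ∫ z, q z ∂μ = 1) (hW : ¬ Integrable (fun x => w x / q x * w x) μ) {v₀ : ℝ}
    (hv₀ : ∫ z, w z ∂μ ≤ v₀) {c : ℝ} (hc : c ≠ 1) :
    ¬ Integrable (fun x => ((if v₀ < w x / q x then (1:ℝ) else 0) - c) ^ 2 * w x
      * (rejCurve μ w q (w x / q x) / (1 - rejCurve μ w q (w x / q x)))) μ := by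
  intro hJ
  set Z : ℝ := ∫ z, w z ∂μ with hZdef
  have hZ : 0 < Z := integral_pos_of_pos hw0 hwi hq1
  have hv₀0 : 0 < v₀ := hZ.trans_le hv₀
  have hb0 : ∀ x, 0 < w x / q x := fun x => div_pos (hw0 x) (hq0 x)
  have hbm : Measurable fun x => w x / q x := hwm.div hqm
  have hcc : 0 < (1 - c) ^ 2 := by
    have : 1 - c ≠ 0 := sub_ne_zero.2 (Ne.symm hc)
    positivity
  have hodds0 : ∀ x, 0 ≤ rejCurve μ w q (w x / q x) / (1 - rejCurve μ w q (w x / q x)) := fun x =>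
    div_nonneg (rejCurve_bounds hw0 hq0 hqi (hb0 x) (μ := μ)).1
      (sub_nonneg.2 (rejCurve_lt_one hw0 hwm hq0 hqm hqi hq1 (hb0 x)).le)
  -- the minorant `h = 1[b > v₀] (1−c)² w (b/Z − 1)`
  set h : X → ℝ := fun x => if v₀ < w x / q x then (1 - c) ^ 2 * w x * (w x / q x / Z - 1) else 0
    with hh
  have hh0 : ∀ x, 0 ≤ h x := fun x => by
    simp only [hh]
    split_ifs with hx
    · refine mul_nonneg (mul_nonneg hcc.le (hw0 x).le) (sub_nonneg.2 ?_)
      rw [le_div_iff₀ hZ, one_mul]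
      exact hv₀.trans hx.le
    · exact le_rfl
  have hhle : ∀ x, h x ≤ ((if v₀ < w x / q x then (1:ℝ) else 0) - c) ^ 2 * w x
      * (rejCurve μ w q (w x / q x) / (1 - rejCurve μ w q (w x / q x))) := fun x => by
    simp only [hh]
    split_ifs with hx
    · exact mul_le_mul_of_nonneg_left (rejOdds_ge hw0 hwm hwi hq0 hqm hqi hq1 (hb0 x))
        (mul_nonneg hcc.le (hw0 x).le)
    · exact mul_nonneg (mul_nonneg (sq_nonneg _) (hw0 x).le) (hodds0 x)
  have hhm : Measurable h :=
    Measurable.ite (measurableSet_lt measurable_const hbm)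
      ((measurable_const.mul hwm).mul ((hbm.div_const Z).sub measurable_const)) measurable_const
  have hhi : Integrable h μ :=
    hJ.mono' hhm.aestronglyMeasurable (Eventually.of_forall fun x => by
      rw [Real.norm_eq_abs, abs_of_nonneg (hh0 x)]; exact hhle x)
  -- then `b w ≤ (Z/(1−c)²) h + Z w + v₀ w` is integrable: contradiction
  have hdom : Integrable (fun x => Z / (1 - c) ^ 2 * h x + Z * w x + v₀ * w x) μ :=
    ((hhi.const_mul _).add (hwi.const_mul Z)).add (hwi.const_mul v₀)
  refine hW (hdom.mono' (hbm.mul hwm).aestronglyMeasurable (Eventually.of_forall fun x => ?_))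
  rw [Real.norm_eq_abs, abs_of_nonneg (mul_nonneg (hb0 x).le (hw0 x).le)]
  simp only [hh]
  have hcne : (1 - c) ^ 2 ≠ 0 := hcc.ne'
  have hZne : Z ≠ 0 := hZ.ne'
  split_ifs with hx
  · have e : Z / (1 - c) ^ 2 * ((1 - c) ^ 2 * w x * (w x / q x / Z - 1)) + Z * w x
        = w x / q x * w x := by
      field_simp
      ring
    have hv : 0 ≤ v₀ * w x := mul_nonneg hv₀0.le (hw0 x).le
    linarith
  · have hle : w x / q x ≤ v₀ := not_lt.1 hx
    have h1 : w x / q x * w x ≤ v₀ * w x := mul_le_mul_of_nonneg_right hle (hw0 x).le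
    have h2 : 0 ≤ Z * w x := mul_nonneg hZ.le (hw0 x).le
    rw [mul_zero, zero_add]
    linarith

/-- **INFINITE SECOND WEIGHT MOMENT ⇒ NON-SUMMABLE AUTOCOVARIANCES** of `g = 1[b > v₀] − c`
(`v₀ ≥ Z`, `c ≠ 1`) along the exact flow sampler. -/
theorem not_summable_autocov_indicator (hw0 : ∀ t, 0 < w t) (hwm : Measurable w)
    (hwi : Integrable w μ) (hq0 : ∀ t, 0 < q t) (hqm : Measurable q) (hqi : Integrable q μ)
    (hq1 : ∫ z, q z ∂μ = 1) (hW : ¬ Integrable (fun x => w x / q x * w x) μ) {v₀ : ℝ}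
    (hv₀ : ∫ z, w z ∂μ ≤ v₀) {c : ℝ} (hc : c ≠ 1) :
    ¬ Summable fun k => ∫ x, ((if v₀ < w x / q x then (1:ℝ) else 0) - c)
        * ((imhOp μ w q)^[k + 1] (fun y => (if v₀ < w y / q y then (1:ℝ) else 0) - c)) x
        * w x ∂μ := by
  intro hs
  obtain ⟨hgm, hgb⟩ := indicator_sub_const_bdd hwm hqm v₀ c
  exact not_integrable_stick_indicator hw0 hwm hwi hq0 hqm hqi hq1 hW hv₀ hc
    (integrable_layerCake_of_summable hw0 hwm hwi hq0 hqm hqi hq1 hgm hgb hs).2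

/-! ## The dichotomy -/

/-- **THE DICHOTOMY FOR THE EXACT FLOW SAMPLER.**  `w, q > 0` measurable integrable, `∫ q = 1`,
`b = w/q`.  Every bounded measurable CENTRED observable (`∫ g w = 0`) has a summable
autocovariance series along the exact chain IF AND ONLY IF the importance weight has a finite
second moment under the model, `∫ b w dμ = E_q[b²] < ∞` — i.e. iff the Kish
effective-sample-size fraction `Z²/E_q[b²]` of i.i.d. model draws is positive. -/
theorem forall_summable_autocov_iff (hw0 : ∀ t, 0 < w t) (hwm : Measurable w)
    (hwi : Integrable w μ) (hq0 : ∀ t, 0 < q t) (hqm : Measurable q) (hqi : Integrable q μ)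
    (hq1 : ∫ z, q z ∂μ = 1) :
    (∀ (g : X → ℝ) (B : ℝ), Measurable g → (∀ t, |g t| ≤ B) → ∫ x, g x * w x ∂μ = 0 →
        Summable fun k => ∫ x, g x * ((imhOp μ w q)^[k + 1] g) x * w x ∂μ)
      ↔ Integrable (fun x => w x / q x * w x) μ := by
  refine ⟨fun hall => ?_, fun hW g B hgm hgb hg0 =>
    summable_autocov_of_weightMoment hw0 hwm hwi hq0 hqm hqi hq1 hW hgm hgb hg0⟩
  by_contra hW
  set Z : ℝ := ∫ z, w z ∂μ with hZdef
  have hZ : 0 < Z := integral_pos_of_pos hw0 hwi hq1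
  -- the centred indicator of `{b > Z}`: `c = (Z − Π(Z))/Z < 1`
  set c : ℝ := (∫ x, (if Z < w x / q x then (1:ℝ) else 0) * w x ∂μ) / Z with hcdef
  have hmass := massLe_self_pos hw0 hwm hwi hq0 hqm hqi hq1
  obtain ⟨-, iL⟩ := integrable_mass_integrands hw0 hwm hwi hqm Z
  have hnum : ∫ x, (if Z < w x / q x then (1:ℝ) else 0) * w x ∂μ = Z - massLe μ w q Z := by
    unfold massLe
    rw [hZdef, ← integral_sub hwi iL]
    refine integral_congr_ae (Eventually.of_forall fun x => ?_)
    show (if (∫ z, w z ∂μ) < w x / q x then (1:ℝ) else 0) * w x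
      = w x - (if w x / q x ≤ ∫ z, w z ∂μ then w x else 0)
    by_cases hx : (∫ z, w z ∂μ) < w x / q x
    · rw [if_pos hx, if_neg (not_le.2 hx), one_mul, sub_zero]
    · rw [if_neg hx, if_pos (not_lt.1 hx), zero_mul, sub_self]
  have hc : c ≠ 1 := by
    intro h1
    rw [hcdef, hnum, div_eq_one_iff_eq hZ.ne'] at h1
    linarith
  obtain ⟨hgm, hgb⟩ := indicator_sub_const_bdd hwm hqm Z c
  have hg0 : ∫ x, ((if Z < w x / q x then (1:ℝ) else 0) - c) * w x ∂μ = 0 := by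
    have i1 : Integrable (fun x => (if Z < w x / q x then (1:ℝ) else 0) * w x) μ := by
      refine Integrable.mono' hwi ((Measurable.ite (measurableSet_lt measurable_const
        (hwm.div hqm)) measurable_const measurable_const).mul hwm).aestronglyMeasurable
        (Eventually.of_forall fun x => ?_)
      rw [Real.norm_eq_abs]
      split_ifs
      · rw [one_mul, abs_of_pos (hw0 x)]
      · rw [zero_mul, abs_zero]; exact (hw0 x).le
    have e : ∀ x, ((if Z < w x / q x then (1:ℝ) else 0) - c) * w x
        = (if Z < w x / q x then (1:ℝ) else 0) * w x - c * w x := fun x => by ring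
    simp_rw [e]
    rw [integral_sub i1 (hwi.const_mul c), integral_const_mul, hcdef]
    field_simp
    ring
  exact not_summable_autocov_indicator hw0 hwm hwi hq0 hqm hqi hq1 hW le_rfl hc
    (hall _ _ hgm hgb hg0)

/-! ## The lattice: row 2's φ⁴ flow sampler -/

section Lattice

variable {n : ℕ}

/-- **FINITE SECOND WEIGHT MOMENT ⇒ FINITE `τ_int` FOR THE φ⁴ FLOW SAMPLER, WITH THE BOUND.**
Every `λ > 0`, real `J`, positive measurable model density `q̃` with `∫ q̃ = 1` and
`∫ (e^{−S}/q̃) e^{−S} dφ < ∞`; `f` bounded measurable, `g = f − ⟨f⟩` (`|g| ≤ B + |⟨f⟩|`).  For every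
`v₀ > 0`, with `Z = ∫ e^{−S}`, `W₂ = ∫ b e^{−S}`, `M(v₀) = ∫ min(e^{−S}, v₀ q̃)`:
`τ_int(f) ≤ ½ + (B + |⟨f⟩|)² (v₀ + Z W₂/M(v₀)² + (W₂ + v₀ Z)/M(v₀)) / ∫ g² e^{−S} dφ`. -/
theorem phi4Flow_tauInt_le_of_weightMoment {lam : ℝ} (hlam : 0 < lam)
    (J : Fin (n + 1) → Fin (n + 1) → ℝ) {q : (Fin (n + 1) → ℝ) → ℝ} (hq0 : ∀ φ, 0 < q φ)
    (hqm : Measurable q) (hqi : Integrable q) (hq1 : ∫ φ, q φ = 1)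
    (hW₂ : Integrable (fun φ => gibbsWeight J lam φ / q φ * gibbsWeight J lam φ))
    {f : (Fin (n + 1) → ℝ) → ℝ} (hfm : Measurable f) {B : ℝ} (hfb : ∀ φ, |f φ| ≤ B)
    {v₀ : ℝ} (hv₀ : 0 < v₀) :
    tauInt (fun k => (∫ φ, (f φ - gibbsExpect J lam f)
        * ((imhOpPhi4 J lam q)^[k] (fun ψ => f ψ - gibbsExpect J lam f)) φ * gibbsWeight J lam φ)
        / ∫ φ, (f φ - gibbsExpect J lam f) ^ 2 * gibbsWeight J lam φ)
      ≤ 1 / 2 + ((B + |gibbsExpect J lam f|) ^ 2 * v₀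
          + (B + |gibbsExpect J lam f|) ^ 2 * ((∫ φ, gibbsWeight J lam φ)
              * ∫ φ, gibbsWeight J lam φ / q φ * gibbsWeight J lam φ)
              / (∫ φ, min (gibbsWeight J lam φ) (v₀ * q φ)) ^ 2
          + (B + |gibbsExpect J lam f|) ^ 2 * ((∫ φ, gibbsWeight J lam φ / q φ * gibbsWeight J lam φ)
              + v₀ * ∫ φ, gibbsWeight J lam φ) / ∫ φ, min (gibbsWeight J lam φ) (v₀ * q φ))
          / ∫ φ, (f φ - gibbsExpect J lam f) ^ 2 * gibbsWeight J lam φ := by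
  obtain ⟨hgm, hgb, hg0⟩ := centred_observable hlam J hfm hfb
  rw [imhOpPhi4_eq_imhOp]
  exact imhOp_tauInt_le_of_weightMoment (μ := volume) (fun ψ => gibbsWeight_pos J lam ψ)
    (continuous_gibbsWeight J lam).measurable (integrable_gibbsWeight hlam J) hq0 hqm hqi hq1
    hW₂ hgm hgb hg0 hv₀

/-- **THE DICHOTOMY FOR THE φ⁴ FLOW SAMPLER**: every bounded measurable observable `f` has a
summable autocovariance series of `f − ⟨f⟩` along row 2's exact sampler IF AND ONLY IF
`∫ (e^{−S}/q̃) e^{−S} dφ < ∞` (finite second moment of the importance weight under the model). -/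
theorem phi4Flow_forall_summable_iff {lam : ℝ} (hlam : 0 < lam)
    (J : Fin (n + 1) → Fin (n + 1) → ℝ) {q : (Fin (n + 1) → ℝ) → ℝ} (hq0 : ∀ φ, 0 < q φ)
    (hqm : Measurable q) (hqi : Integrable q) (hq1 : ∫ φ, q φ = 1) :
    (∀ (f : (Fin (n + 1) → ℝ) → ℝ) (B : ℝ), Measurable f → (∀ φ, |f φ| ≤ B) →
        Summable fun k => ∫ φ, (f φ - gibbsExpect J lam f)
          * ((imhOpPhi4 J lam q)^[k + 1] (fun ψ => f ψ - gibbsExpect J lam f)) φ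
          * gibbsWeight J lam φ)
      ↔ Integrable (fun φ => gibbsWeight J lam φ / q φ * gibbsWeight J lam φ) := by
  have hgen := forall_summable_autocov_iff (μ := volume) (fun ψ => gibbsWeight_pos J lam ψ)
    (continuous_gibbsWeight J lam).measurable (integrable_gibbsWeight hlam J) hq0 hqm hqi hq1
  rw [imhOpPhi4_eq_imhOp]
  constructor
  · intro hall
    refine hgen.1 fun g B hgm hgb hg0 => ?_
    -- a centred `g` has `⟨g⟩ = 0`, so `g − ⟨g⟩ = g`
    have hE : gibbsExpect J lam g = 0 := by
      unfold gibbsExpect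
      rw [hg0, zero_div]
    have h := hall g B hgm hgb
    simp only [hE, sub_zero] at h
    exact h
  · intro hW f B hfm hfb
    obtain ⟨hgm, hgb, hg0⟩ := centred_observable hlam J hfm hfb
    exact hgen.2 hW _ _ hgm hgb hg0

end Lattice

end Summit.Ventures.LatticeQCDFlow.Exactness
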